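import Summits.KontsevichZagierPeriods.KontsevichZagierPeriods.Theorems.LogPrimitiveNL.Negative.Rigidity
import Summits.KontsevichZagierPeriods.KontsevichZagierPeriods.Theorems.LiouvilleUnfoldingLogPrimitiveNLGlue
import Summits.KontsevichZagierPeriods.KontsevichZagierPeriods.Theorems.LiouvilleUnfoldingLogPrimitiveNLStubMinNormalisation
import Summits.KontsevichZagierPeriods.KontsevichZagierPeriods.Theorems.LiouvilleUnfoldingLogPrimitiveNLStubTransfer
import Summits.KontsevichZagierPeriods.KontsevichZagierPeriods.Theorems.LiouvilleUnfoldingLogPrimitiveNLStubConeDecomposition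
import Summits.KontsevichZagierPeriods.KontsevichZagierPeriods.Theorems.LiouvilleUnfoldingLogPrimitiveNLStubCellwiseFold
import Summits.KontsevichZagierPeriods.KontsevichZagierPeriods.Theorems.LiouvilleUnfoldingLogPrimitiveNLStubConstBlockDescent
import Summits.KontsevichZagierPeriods.KontsevichZagierPeriods.Theorems.LiouvilleUnfoldingLogPrimitiveNLStubTaylorMorphism
import Summits.KontsevichZagierPeriods.KontsevichZagierPeriods.Theorems.LiouvilleUnfoldingLogPrimitiveNLStubOneVarSemialgebraic
import Summits.KontsevichZagierPeriods.KontsevichZagierPeriods.Theorems.LiouvilleUnfoldingLogPrimitiveNLStubRosenlichtProperty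
import Summits.KontsevichZagierPeriods.KontsevichZagierPeriods.Theorems.LiouvilleUnfoldingLogPrimitiveNLStubAbstractLogLinear
import Summits.KontsevichZagierPeriods.KontsevichZagierPeriods.Theorems.LiouvilleUnfoldingLogPrimitiveNLStubUniformCells
import Summits.KontsevichZagierPeriods.KontsevichZagierPeriods.Theorems.LiouvilleUnfoldingLogPrimitiveNLStructureMain

/-!
# Crux `LogPrimitiveNL` (stmt-KontsevichZagierPeriods-2836) — SECOND, independent proof: closing composition of line
`ax-schanuel-germs` (second lead; the item is already closed `proved` by line `logderiv-peeling`'s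
`LogPrimitiveNL.LogPrimitiveNL_of`, 600e673676c9)

`LogPrimitiveNL_of : LogPrimitiveNL` (the route decl BY NAME) from the line's landed stubs: the transfer
layer shared with line `logderiv-peeling` (`stub_minNormalisation`, `stub_transfer`), boundary rigidity
from the shared fold (`stub_coneDecomposition`, `stub_cellwiseFold`) on top of THIS line's structure
theorem `AxSchanuelGerms.stub_structure` (engine: Taylor transport into `ℝ⸨X⸩`, Rosenlicht/Ax
differential algebra over the algebraic elements, flatness of `C^∞` semialgebraic functions, Baker in
relation-span form, uniform cells), fed with its six landed engine stubs.
-/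

noncomputable section

open Set MeasureTheory Filter
open scoped ContDiff Topology LaurentSeries RatFunc
open Literature.NumberTheory.Transcendental Literature.ModelTheory.ExponentialFields

namespace Summit.KontsevichZagierPeriods.LiouvilleUnfolding.LogPrimitiveNL.AxSchanuelGerms

open Summit.KontsevichZagierPeriods.KontsevichZagierPeriods.Theses.LiouvilleUnfolding (LogPrimitiveNL)

/-- **Structure + fold ⇒ boundary rigidity.** The structure theorem (applied to
`g.integrand = Σ hᵢ log Wᵢ` on `g.domain`) gives cells on which `g.integrand = 0` — so `[g]` is a
relation (`of_mem_relations_of_eqOn_zero_off_null`, landed glue of line `logderiv-peeling`) — and the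
lattice structure that the shared cellwise fold turns into `Σ [Uᵢ] ∈ relations`. -/
theorem boundaryRigidity_of_structure : Negative.BoundaryRigidity := by
  intro n k g h W U hh hW hW1 hUd hUi hUint hg
  have hσ : IsSemialgebraic ℚ g.domain := g.isSemialgebraic_domain
  have hWpos : ∀ i, ∀ x ∈ g.domain, 0 < W i x := fun i x hx => one_pos.trans_le (hW1 i x hx)
  obtain ⟨N, C, hC, hdisj, hnull, hcell⟩ :=
    stub_structure stub_taylorMorphism stub_oneVarSemialgebraic stub_rosenlichtProperty
      stub_abstractLogLinear stub_constBlockDescent stub_uniformCells n k g.domain h W g.integrand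
      hσ hh hW hWpos g.isSemialgebraicFunOn_integrand (fun x hx => (hg x hx).symm)
  have hfold : ∑ i, KZ.of (U i) ∈ KZ.relations :=
    stub_cellwiseFold stub_coneDecomposition n k g.domain h W U N C hσ hh hW hW1 hUd hUi hUint hC
      hdisj hnull (fun c => (hcell c).2)
  have hA : IsSemialgebraic ℚ (⋃ c, C c) := by
    have : (⋃ c, C c) = ⋃ c ∈ (Finset.univ : Finset (Fin N)), C c := by simp
    rw [this]
    exact IsSemialgebraic.biUnion _ _ fun c _ => (hC c).1
  have hg0 : KZ.of g ∈ KZ.relations := by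
    refine of_mem_relations_of_eqOn_zero_off_null n g (⋃ c, C c) hA
      (iUnion_subset fun c => (hC c).2.2) hnull fun x hx => ?_
    obtain ⟨c, hxc⟩ := mem_iUnion.1 hx
    exact (hcell c).1 x hxc
  exact KZ.relations.sub_mem hfold hg0

/-- **The composition**: the crux `LogPrimitiveNL`, BY NAME, from the stubs (shared transfer with the
LANDED min-normalisation `stub_minNormalisation` of line `logderiv-peeling`). -/
theorem LogPrimitiveNL_of :
    Summit.KontsevichZagierPeriods.KontsevichZagierPeriods.Theses.LiouvilleUnfolding.LogPrimitiveNL :=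
  fun n k r r' a b h V V' =>
    stub_transfer stub_minNormalisation boundaryRigidity_of_structure n k r r' a b h V V'

end Summit.KontsevichZagierPeriods.LiouvilleUnfolding.LogPrimitiveNL.AxSchanuelGerms

end
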